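import Summits.ResolutionOfSingularities.ResolutionOfSingularities.Theorems.WeightedInvariantOrbitCentreHomogeneousBaseChange
import Summits.ResolutionOfSingularities.ResolutionOfSingularities.Theorems.WeightedInvariantE2SmoothLocalization
import Summits.ResolutionOfSingularities.ResolutionOfSingularities.Theorems.WeightedInvariantE2ModelPrimary
import Summits.ResolutionOfSingularities.ResolutionOfSingularities.Theorems.WeightedInvariantE2HomogeneousShrink
import HarnessLib

/-!
# E2 centre, ring-level hand (G-0), part (c), II: CORE INVARIANCE of the (open″) clauses from the rung, via the GENERIC
# TORUS TRANSLATE `A_𝔮 → A[ℤʲ]_{𝔮·A[ℤʲ]} ← A_{𝔮*}`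

[OURS · L1 W4.3 · DOOR `HypersurfaceCentreConstruction` stmt-ResolutionOfSingularities-19897 · E2 tier, centre piece
(C-c) `E2CentreGlueBody`, DESIGN MEMO v0 `L/res-L1-w43-plan-1/E2-CENTRE-GLUE-DESIGN-v0.md` (registrar res-L1-w43-plan-1)
§2 (G-0) HOMOGENEOUS CHART, «base change input»; ring-level hand res-L1-s36-pv-1, SHAPE LINE (HOME/STATUS 2026-08-27
l.70636) part (c).  Commutative algebra on OUR clause vocabulary ((c11)≤d `IotaJEssSmoothCompatibleLE`,
`IotaUnitInvariant`, `JUnitInvariant`); nothing here is a statement of, or about, the manuscript under adjudication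
(Hironaka 2017); candidate-design support, AI-written, weaker than expert review.]

## The mechanism (no density, finite ground fields allowed)

`A` a Noetherian ring graded by `𝒜 : (Fin j → ℤ) → AddSubgroup A`, `M = ℤʲ`, `A[M]` the group algebra (the torus times
`Spec A`), `ι₀ = singleZeroRingHom : A → A[M]` (projection) and `ρ : A → A[M]` the COACTION (`a_d ↦ a_d [d]`,
`exists_coaction`); both are smooth ring maps (`smooth_singleZeroRingHom`, `smooth_coaction`).  For a prime `𝔮` of `A`
put `𝔔 := 𝔮 · A[M]` (prime) and `B := A[M]_𝔔` — the GENERIC TRANSLATE.  Then `ι₀⁻¹ 𝔔 = 𝔮` while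
`ρ⁻¹ 𝔔 = 𝔮*` is the HOMOGENEOUS CORE (`comap_coaction_map_singleZeroRingHom`): the two legs
`A_𝔮 → B ← A_{𝔮*}` are local, formally smooth, essentially of finite type (`…E2SmoothLocalization`),
`B` is regular if `A_𝔮` is (flat ascent with `𝔪_𝔮 B = 𝔪_B`) and then `A_{𝔮*}` is regular (flat descent), and
`dim B = dim A_𝔮`.  For HOMOGENEOUS `F` of degree `d`, `ρ F = F·[d] = ι₀ F · unit`.  Hence, from the rung:

* `iota_localization_homogeneousCore_eq` — [H-Top, ι]: (c11)≤e on both legs + `IotaUnitInvariant` ⇒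
  `ι(A_{𝔮*}, F) = ι(A_𝔮, F)` whenever `A_𝔮` is regular of dimension `≤ e`;
* `mem_sq_maximalIdeal_localization_homogeneousCore_iff` — [H-Top, order]: `F ∈ 𝔪_{𝔮*}ⁿ ↔ F ∈ 𝔪_𝔮ⁿ`
  (`mem_pow_maximalIdeal_iff_of_formallySmooth_essFiniteType` on both legs);
* `J_map_localization_homogeneousCore_eq` — the intrinsic J-transport `J(A_𝔮, F)·B = J(A_{𝔮*}, F)·B` ((c11) J-half +
  `JUnitInvariant`), and `jeq_localization_of_jeq_homogeneousCore` — [H-J]: for HOMOGENEOUS `Uᵢ`,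
  `J(A_{𝔮*}, F)_m = 𝒥_m(U, W)·A_{𝔮*} ∀ m ⇒ J(A_𝔮, F)_m = 𝒥_m(U, W)·A_𝔮 ∀ m` (unit rescaling
  `weightedMonomialIdeal_unit_mul` + faithful flatness of `A_𝔮 → B`);
* bookkeeping: `ringKrullDim_localization_homogeneousCore_le`, `isRegularLocalRing_localization_homogeneousCore`.

With part (b) (`E2Model.exists_isHomogeneousElem_forall_clause`, …E2HomogeneousShrink) these give the homogeneous
localising element for any (open″)≤3 presentation whose `Uᵢ` are homogeneous (closer in the sequel, on the registrar's
(Δ11) words).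
-/

set_option linter.dupNamespace false

noncomputable section

open IsLocalRing AddMonoidAlgebra
open Literature.AlgebraicGeometry.Resolution
open Summit.ResolutionOfSingularities.ResolutionOfSingularities.Theorems.DatumToEmbedded.CentreHomogeneous
open Summit.ResolutionOfSingularities.ResolutionOfSingularities.Theorems.OrbitCentreHomogeneous

namespace Summit.ResolutionOfSingularities.ResolutionOfSingularities.Cruxes.HypersurfaceCentreConstruction.LocalEngine

namespace E2Model

/-! ## §2 The generic translate: `ι₀`, the coaction `ρ`, the prime `𝔮·A[M]`, and `ρ⁻¹(𝔮·A[M]) = 𝔮*` -/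

section Translate

variable {j : ℕ} {A : Type} [CommRing A] (𝒜 : (Fin j → ℤ) → AddSubgroup A) [GradedRing 𝒜]
  (ρ : A →+* A[Fin j → ℤ]) (hρ : ∀ (i : Fin j → ℤ) (a : A), a ∈ 𝒜 i → ρ a = single i a)

include hρ in
/-- **The coaction pulls `𝔮 · A[M]` back to the HOMOGENEOUS CORE of `𝔮`**: `ρ a ∈ 𝔮·A[M]` iff every coefficient
`a_d` of `ρ a` lies in `𝔮`. [OURS · DESIGN MEMO v0 §2 (G-0) (c)] -/
theorem comap_coaction_map_singleZeroRingHom (𝔮 : Ideal A) :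
    (𝔮.map (singleZeroRingHom : A →+* A[Fin j → ℤ])).comap ρ = (𝔮.homogeneousCore 𝒜).toIdeal := by
  classical
  ext a
  rw [Ideal.mem_comap, mem_homogeneousCore_iff_forall_decompose]
  constructor
  · intro h d
    have := coeff_mem_of_mem_map h d
    rwa [coeff_coaction 𝒜 ρ hρ] at this
  · intro h
    refine mem_map_of_coeff_mem fun d => ?_
    rw [coeff_coaction 𝒜 ρ hρ]
    exact h d

omit [GradedRing 𝒜] in
include hρ in
/-- For a homogeneous `F` of degree `d`: `ρ F = ι₀ F · [d]`, and `[d]` is a unit of `A[M]`. [OURS · bookkeeping] -/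
theorem coaction_eq_single_zero_mul_unit {F : A} {d : Fin j → ℤ} (hF : F ∈ 𝒜 d) :
    ∃ v : A[Fin j → ℤ], IsUnit v ∧ ρ F = v * singleZeroRingHom F := by
  refine ⟨single d 1, ?_, ?_⟩
  · refine IsUnit.of_mul_eq_one (single (-d) 1) ?_
    rw [single_mul_single, add_neg_cancel, mul_one]
    rfl
  · rw [hρ d F hF, singleZeroRingHom_eq, single_mul_single, add_zero, one_mul]

end Translate

/-! ## §3 Unit rescaling of the generators of a weighted monomial ideal -/

section UnitRescale

variable {R : Type*} [CommRing R] {N : ℕ}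

/-- Rescaling the generators by units does not change the weighted monomial ideals. [OURS · folklore bookkeeping] -/
theorem weightedMonomialIdeal_unit_mul (u : Fin N → R) (v : Fin N → R) (hv : ∀ i, IsUnit (v i))
    (w : Fin N → ℕ) (n : ℕ) :
    weightedMonomialIdeal (fun i => v i * u i) w n = weightedMonomialIdeal u w n := by
  have hgen : ∀ α : Fin N → ℕ, ∏ i, (v i * u i) ^ α i = (∏ i, v i ^ α i) * ∏ i, u i ^ α i := by
    intro α
    rw [← Finset.prod_mul_distrib]
    exact Finset.prod_congr rfl fun i _ => mul_pow _ _ _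
  have hunit : ∀ α : Fin N → ℕ, IsUnit (∏ i, v i ^ α i) := fun α =>
    IsUnit.prod_univ_iff.mpr fun i => (hv i).pow _
  unfold weightedMonomialIdeal
  refine le_antisymm (Ideal.span_le.mpr ?_) (Ideal.span_le.mpr ?_)
  · rintro _ ⟨α, hα, rfl⟩
    rw [hgen]
    exact Ideal.mul_mem_left _ _ (Ideal.subset_span ⟨α, hα, rfl⟩)
  · rintro _ ⟨α, hα, rfl⟩
    have hmem : ∏ i, (v i * u i) ^ α i ∈ Ideal.span {x | ∃ α : Fin N → ℕ, n ≤ ∑ i, w i * α i ∧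
        x = ∏ i, (v i * u i) ^ α i} := Ideal.subset_span ⟨α, hα, rfl⟩
    rw [hgen] at hmem
    exact (Ideal.unit_mul_mem_iff_mem _ (hunit α)).mp hmem

end UnitRescale

/-! ## §4 Core invariance of the (open″) clauses at a prime `𝔮` with homogeneous core `𝔮*` -/

section Core

variable {j : ℕ} {A : Type} [CommRing A] [IsNoetherianRing A] (𝒜 : (Fin j → ℤ) → AddSubgroup A) [GradedRing 𝒜]
  (𝔮 : Ideal A) [𝔮.IsPrime] (𝔮' : Ideal A) [𝔮'.IsPrime] (h𝔮' : 𝔮' = (𝔮.homogeneousCore 𝒜).toIdeal)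

omit [IsNoetherianRing A] in
include h𝔮' in
/-- `dim A_{𝔮*} ≤ dim A_𝔮` (`𝔮* ≤ 𝔮`, heights are monotone). [OURS · bookkeeping] -/
theorem ringKrullDim_localization_homogeneousCore_le :
    ringKrullDim (Localization.AtPrime 𝔮') ≤ ringKrullDim (Localization.AtPrime 𝔮) := by
  rw [IsLocalization.AtPrime.ringKrullDim_eq_height 𝔮' (Localization.AtPrime 𝔮'),
    IsLocalization.AtPrime.ringKrullDim_eq_height 𝔮 (Localization.AtPrime 𝔮)]
  exact WithBot.coe_le_coe.mpr (Ideal.height_mono (h𝔮' ▸ Ideal.toIdeal_homogeneousCore_le 𝒜 𝔮))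

omit [IsNoetherianRing A] [𝔮'.IsPrime] in
include h𝔮' in
/-- **The two legs, packaged**: a coaction `ρ`, the prime `𝔔 = 𝔮·A[M]` of the generic translate, `ι₀⁻¹ 𝔔 = 𝔮` and
`ρ⁻¹ 𝔔 = 𝔮*`. [OURS · bookkeeping] -/
theorem exists_translate :
    ∃ (ρ : A →+* A[Fin j → ℤ]) (_ : ∀ (i : Fin j → ℤ) (a : A), a ∈ 𝒜 i → ρ a = single i a)
      (𝔔 : Ideal A[Fin j → ℤ]) (_ : 𝔔.IsPrime),
      𝔔 = 𝔮.map (singleZeroRingHom : A →+* A[Fin j → ℤ]) ∧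
      𝔮 = 𝔔.comap (singleZeroRingHom : A →+* A[Fin j → ℤ]) ∧ 𝔮' = 𝔔.comap ρ := by
  classical
  obtain ⟨ρ, hρ⟩ := exists_coaction 𝒜 (M := Fin j → ℤ)
  refine ⟨ρ, hρ, 𝔮.map (singleZeroRingHom : A →+* A[Fin j → ℤ]), isPrime_map_singleZeroRingHom 𝔮, rfl,
    (comap_map_singleZeroRingHom 𝔮).symm, ?_⟩
  rw [h𝔮', comap_coaction_map_singleZeroRingHom 𝒜 ρ hρ]

include h𝔮' in
/-- **The regular locus is core-stable**: `A_𝔮` regular ⇒ `A_{𝔮*}` regular (ascent to the generic translate along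
`ι₀`, descent along the coaction `ρ`). [OURS · DESIGN MEMO v0 §2 (G-0) (c)] -/
theorem isRegularLocalRing_localization_homogeneousCore [hreg : IsRegularLocalRing (Localization.AtPrime 𝔮)] :
    IsRegularLocalRing (Localization.AtPrime 𝔮') := by
  classical
  obtain ⟨ρ, hρ, 𝔔, h𝔔p, h𝔔, h1, h2⟩ := exists_translate 𝒜 𝔮 𝔮' h𝔮'
  haveI : IsNoetherianRing A[Fin j → ℤ] := Algebra.FiniteType.isNoetherianRing A _
  have hB : IsRegularLocalRing (Localization.AtPrime 𝔔) :=
    @isRegularLocalRing_localization_of_map_eq A A[Fin j → ℤ] _ _ singleZeroRingHom 𝔔 h𝔔p 𝔮 _ h1 _ _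
      (smooth_singleZeroRingHom A j) h𝔔.symm hreg
  exact @isRegularLocalRing_localization_of_smooth_comap A A[Fin j → ℤ] _ _ ρ 𝔔 h𝔔p 𝔮' _ h2 _
    (smooth_coaction 𝒜 ρ hρ) hB

include h𝔮' in
/-- **The singular locus is core-stable**: `A_{𝔮*}` regular ⇒ `A_𝔮` regular (ascent along the coaction leg `ρ` — flat,
regular closed fibre —, descent along `ι₀`).  With `isRegularLocalRing_localization_homogeneousCore`: regularity of `A_𝔮` is
a property of the core `𝔮*`, i.e. `Sing(A)` is cut out by a homogeneous ideal. [OURS · DESIGN MEMO v0 §2 (G-0) (d)] -/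
theorem isRegularLocalRing_localization_of_homogeneousCore [hreg' : IsRegularLocalRing (Localization.AtPrime 𝔮')] :
    IsRegularLocalRing (Localization.AtPrime 𝔮) := by
  classical
  obtain ⟨ρ, hρ, 𝔔, h𝔔p, h𝔔, h1, h2⟩ := exists_translate 𝒜 𝔮 𝔮' h𝔮'
  haveI : IsNoetherianRing A[Fin j → ℤ] := Algebra.FiniteType.isNoetherianRing A _
  have hB : IsRegularLocalRing (Localization.AtPrime 𝔔) :=
    @isRegularLocalRing_localization_of_smooth A A[Fin j → ℤ] _ _ ρ 𝔔 h𝔔p 𝔮' _ h2 _ _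
      (smooth_coaction 𝒜 ρ hρ) hreg'
  exact @isRegularLocalRing_localization_of_smooth_comap A A[Fin j → ℤ] _ _ singleZeroRingHom 𝔔 h𝔔p 𝔮 _ h1 _
    (smooth_singleZeroRingHom A j) hB

include h𝔮' in
/-- **[H-Top, order part]: `F ∈ 𝔪_{𝔮*}ⁿ ↔ F ∈ 𝔪_𝔮ⁿ` for HOMOGENEOUS `F`** (read both memberships in the generic
translate `B`, where `ρ F` and `ι₀ F` differ by a unit). [OURS · DESIGN MEMO v0 §2 (G-0) (c)] -/
theorem mem_pow_maximalIdeal_localization_homogeneousCore_iff {F : A} (hF : SetLike.IsHomogeneousElem 𝒜 F) (n : ℕ) :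
    algebraMap A (Localization.AtPrime 𝔮') F ∈ maximalIdeal (Localization.AtPrime 𝔮') ^ n ↔
      algebraMap A (Localization.AtPrime 𝔮) F ∈ maximalIdeal (Localization.AtPrime 𝔮) ^ n := by
  classical
  obtain ⟨d, hFd⟩ := hF
  obtain ⟨ρ, hρ, 𝔔, h𝔔p, h𝔔, h1, h2⟩ := exists_translate 𝒜 𝔮 𝔮' h𝔮'
  haveI : IsNoetherianRing A[Fin j → ℤ] := Algebra.FiniteType.isNoetherianRing A _
  rw [@mem_pow_maximalIdeal_localization_iff_of_smooth A A[Fin j → ℤ] _ _ singleZeroRingHom 𝔔 h𝔔p 𝔮 _ h1 _ _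
      (smooth_singleZeroRingHom A j) n F,
    @mem_pow_maximalIdeal_localization_iff_of_smooth A A[Fin j → ℤ] _ _ ρ 𝔔 h𝔔p 𝔮' _ h2 _ _
      (smooth_coaction 𝒜 ρ hρ) n F]
  obtain ⟨v, hv, hvF⟩ := coaction_eq_single_zero_mul_unit 𝒜 ρ hρ hFd
  rw [hvF, map_mul]
  exact Ideal.unit_mul_mem_iff_mem _ (hv.map _)

include h𝔮' in
/-- **[H-Top, ι part]: `ι(A_{𝔮*}, F) = ι(A_𝔮, F)` for HOMOGENEOUS `F`** when `A_𝔮` is regular of dimension `≤ e`, from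
(c11)≤e on the two legs of the generic translate and `IotaUnitInvariant`. [OURS · DESIGN MEMO v0 §2 (G-0) (c)] -/
theorem iota_localization_homogeneousCore_eq {e : ℕ} {ι : (R : Type) → [CommRing R] → R → Ordinal.{0}}
    {J : (R : Type) → [CommRing R] → R → ℕ → Ideal R} (hc11 : IotaJEssSmoothCompatibleLE e ι J)
    (hunit : IotaUnitInvariant ι) [hreg : IsRegularLocalRing (Localization.AtPrime 𝔮)]
    (he : ringKrullDim (Localization.AtPrime 𝔮) ≤ e) {F : A} (hF : SetLike.IsHomogeneousElem 𝒜 F) :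
    ι (Localization.AtPrime 𝔮') (algebraMap A _ F) = ι (Localization.AtPrime 𝔮) (algebraMap A _ F) := by
  classical
  obtain ⟨d, hFd⟩ := hF
  obtain ⟨ρ, hρ, 𝔔, h𝔔p, h𝔔, h1, h2⟩ := exists_translate 𝒜 𝔮 𝔮' h𝔮'
  haveI : IsNoetherianRing A[Fin j → ℤ] := Algebra.FiniteType.isNoetherianRing A _
  have hB : IsRegularLocalRing (Localization.AtPrime 𝔔) :=
    @isRegularLocalRing_localization_of_map_eq A A[Fin j → ℤ] _ _ singleZeroRingHom 𝔔 h𝔔p 𝔮 _ h1 _ _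
      (smooth_singleZeroRingHom A j) h𝔔.symm hreg
  have hreg' : IsRegularLocalRing (Localization.AtPrime 𝔮') :=
    @isRegularLocalRing_localization_of_smooth_comap A A[Fin j → ℤ] _ _ ρ 𝔔 h𝔔p 𝔮' _ h2 _
      (smooth_coaction 𝒜 ρ hρ) hB
  have hdimB : ringKrullDim (Localization.AtPrime 𝔔) ≤ e := by
    rw [ringKrullDim_eq_of_isLocalization_atPrime_map 𝔮 (Localization.AtPrime 𝔮) 𝔔 h𝔔 (Localization.AtPrime 𝔔)]
    exact he
  have leg1 := (@iotaJ_localization_eq_of_smooth A A[Fin j → ℤ] _ _ singleZeroRingHom 𝔔 h𝔔p 𝔮 _ h1 e ι J hc11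
    (smooth_singleZeroRingHom A j) hreg hB hdimB F).1
  have leg2 := (@iotaJ_localization_eq_of_smooth A A[Fin j → ℤ] _ _ ρ 𝔔 h𝔔p 𝔮' _ h2 e ι J hc11
    (smooth_coaction 𝒜 ρ hρ) hreg' hB hdimB F).1
  obtain ⟨v, hv, hvF⟩ := coaction_eq_single_zero_mul_unit 𝒜 ρ hρ hFd
  rw [← leg1, ← leg2, hvF, map_mul]
  exact hunit _ _ _ (hv.map _)

/-- **The intrinsic J-transport**: in the generic translate `B = A[M]_{𝔮·A[M]}`,
`J(A_𝔮, F)_m · B = J(A_{𝔮*}, F)_m · B` (extended along `ι₀` resp. the coaction), for homogeneous `F`, from the J-half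
of (c11)≤e and `JUnitInvariant`.  (At a HOMOGENEOUS `𝔮 = 𝔮*` this is the TWIST-STABILITY `ρ(𝔍)·B = ι₀(𝔍)·B` of
`𝔍 = J(A_𝔮, F)_m` — the (U-a) input of board item (o47-c-U).) [OURS · DESIGN MEMO v0 §2 (G-0) (c)] -/
theorem J_map_localization_homogeneousCore_eq {e : ℕ} {ι : (R : Type) → [CommRing R] → R → Ordinal.{0}}
    {J : (R : Type) → [CommRing R] → R → ℕ → Ideal R} (hc11 : IotaJEssSmoothCompatibleLE e ι J)
    (hJunit : JUnitInvariant J) [hreg : IsRegularLocalRing (Localization.AtPrime 𝔮)]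
    (he : ringKrullDim (Localization.AtPrime 𝔮) ≤ e) {F : A} (hF : SetLike.IsHomogeneousElem 𝒜 F)
    (ρ : A →+* A[Fin j → ℤ]) (hρ : ∀ (i : Fin j → ℤ) (a : A), a ∈ 𝒜 i → ρ a = single i a)
    (𝔔 : Ideal A[Fin j → ℤ]) [h𝔔p : 𝔔.IsPrime] (h𝔔 : 𝔔 = 𝔮.map (singleZeroRingHom : A →+* A[Fin j → ℤ]))
    (h1 : 𝔮 = 𝔔.comap (singleZeroRingHom : A →+* A[Fin j → ℤ])) (h2 : 𝔮' = 𝔔.comap ρ) (m : ℕ) :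
    (J (Localization.AtPrime 𝔮) (algebraMap A _ F) m).map (Localization.localRingHom 𝔮 𝔔 singleZeroRingHom h1) =
      (J (Localization.AtPrime 𝔮') (algebraMap A _ F) m).map (Localization.localRingHom 𝔮' 𝔔 ρ h2) := by
  classical
  obtain ⟨d, hFd⟩ := hF
  haveI : IsNoetherianRing A[Fin j → ℤ] := Algebra.FiniteType.isNoetherianRing A _
  have hB : IsRegularLocalRing (Localization.AtPrime 𝔔) :=
    @isRegularLocalRing_localization_of_map_eq A A[Fin j → ℤ] _ _ singleZeroRingHom 𝔔 h𝔔p 𝔮 _ h1 _ _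
      (smooth_singleZeroRingHom A j) h𝔔.symm hreg
  have hreg' : IsRegularLocalRing (Localization.AtPrime 𝔮') :=
    @isRegularLocalRing_localization_of_smooth_comap A A[Fin j → ℤ] _ _ ρ 𝔔 h𝔔p 𝔮' _ h2 _
      (smooth_coaction 𝒜 ρ hρ) hB
  have hdimB : ringKrullDim (Localization.AtPrime 𝔔) ≤ e := by
    rw [ringKrullDim_eq_of_isLocalization_atPrime_map 𝔮 (Localization.AtPrime 𝔮) 𝔔 h𝔔 (Localization.AtPrime 𝔔)]
    exact he
  have leg1 := (@iotaJ_localization_eq_of_smooth A A[Fin j → ℤ] _ _ singleZeroRingHom 𝔔 h𝔔p 𝔮 _ h1 e ι J hc11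
    (smooth_singleZeroRingHom A j) hreg hB hdimB F).2 m
  have leg2 := (@iotaJ_localization_eq_of_smooth A A[Fin j → ℤ] _ _ ρ 𝔔 h𝔔p 𝔮' _ h2 e ι J hc11
    (smooth_coaction 𝒜 ρ hρ) hreg' hB hdimB F).2 m
  obtain ⟨v, hv, hvF⟩ := coaction_eq_single_zero_mul_unit 𝒜 ρ hρ hFd
  rw [← leg1, ← leg2, hvF, map_mul]
  exact (hJunit _ _ _ m (hv.map _)).symm

include h𝔮' in
/-- **[H-J]: for HOMOGENEOUS `Uᵢ`, the J-clause descends from the core**: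
`(∀ m, J(A_{𝔮*}, F)_m = 𝒥_m(U, W)·A_{𝔮*}) → ∀ m, J(A_𝔮, F)_m = 𝒥_m(U, W)·A_𝔮`.  Both sides extend to the SAME ideal
of the generic translate `B` (`J` by `J_map_localization_homogeneousCore_eq`; `𝒥(U, W)` because `ρ Uᵢ = ι₀ Uᵢ · unit`,
`weightedMonomialIdeal_unit_mul`), and `A_𝔮 → B` is faithfully flat. [OURS · DESIGN MEMO v0 §2 (G-0) (c)] -/
theorem jeq_localization_of_jeq_homogeneousCore {e : ℕ} {ι : (R : Type) → [CommRing R] → R → Ordinal.{0}}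
    {J : (R : Type) → [CommRing R] → R → ℕ → Ideal R} (hc11 : IotaJEssSmoothCompatibleLE e ι J)
    (hJunit : JUnitInvariant J) [hreg : IsRegularLocalRing (Localization.AtPrime 𝔮)]
    (he : ringKrullDim (Localization.AtPrime 𝔮) ≤ e) {F : A} (hF : SetLike.IsHomogeneousElem 𝒜 F)
    {N : ℕ} (U : Fin N → A) (W : Fin N → ℕ) (hU : ∀ i, SetLike.IsHomogeneousElem 𝒜 (U i))
    (hJeq : ∀ m : ℕ, J (Localization.AtPrime 𝔮') (algebraMap A _ F) m =
      (weightedMonomialIdeal U W m).map (algebraMap A (Localization.AtPrime 𝔮'))) (m : ℕ) :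
    J (Localization.AtPrime 𝔮) (algebraMap A _ F) m =
      (weightedMonomialIdeal U W m).map (algebraMap A (Localization.AtPrime 𝔮)) := by
  classical
  obtain ⟨ρ, hρ, 𝔔, h𝔔p, h𝔔, h1, h2⟩ := exists_translate 𝒜 𝔮 𝔮' h𝔮'
  haveI : IsNoetherianRing A[Fin j → ℤ] := Algebra.FiniteType.isNoetherianRing A _
  have key := J_map_localization_homogeneousCore_eq 𝒜 𝔮 𝔮' hc11 hJunit he hF ρ hρ 𝔔 h𝔔 h1 h2 m
  rw [hJeq m, Ideal.map_map] at key
  -- the extension of `𝒥_m(U, W)` along `ψ₂ ∘ (A → A_{𝔮*}) = (A[M] → B) ∘ ρ` equals that along `(A[M] → B) ∘ ι₀`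
  have hcomp₂ : (Localization.localRingHom 𝔮' 𝔔 ρ h2).comp (algebraMap A (Localization.AtPrime 𝔮')) =
      (algebraMap A[Fin j → ℤ] (Localization.AtPrime 𝔔)).comp ρ := by
    ext a
    exact Localization.localRingHom_to_map 𝔮' 𝔔 ρ h2 a
  have hcomp₁ : (Localization.localRingHom 𝔮 𝔔 singleZeroRingHom h1).comp (algebraMap A (Localization.AtPrime 𝔮)) =
      (algebraMap A[Fin j → ℤ] (Localization.AtPrime 𝔔)).comp singleZeroRingHom := by
    ext a
    exact Localization.localRingHom_to_map 𝔮 𝔔 singleZeroRingHom h1 a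
  have hU' : ∀ i, ∃ v : Localization.AtPrime 𝔔, IsUnit v ∧
      ((algebraMap A[Fin j → ℤ] (Localization.AtPrime 𝔔)).comp ρ) (U i) =
        v * ((algebraMap A[Fin j → ℤ] (Localization.AtPrime 𝔔)).comp singleZeroRingHom) (U i) := by
    intro i
    obtain ⟨d, hd⟩ := hU i
    obtain ⟨v, hv, hvU⟩ := coaction_eq_single_zero_mul_unit 𝒜 ρ hρ hd
    exact ⟨algebraMap _ _ v, hv.map _, by simp [hvU]⟩
  choose v hv hvU using hU'
  have hrescale : (weightedMonomialIdeal U W m).map ((algebraMap A[Fin j → ℤ] (Localization.AtPrime 𝔔)).comp ρ) =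
      (weightedMonomialIdeal U W m).map ((algebraMap A[Fin j → ℤ] (Localization.AtPrime 𝔔)).comp singleZeroRingHom) := by
    rw [map_weightedMonomialIdeal', map_weightedMonomialIdeal']
    have : (⇑((algebraMap A[Fin j → ℤ] (Localization.AtPrime 𝔔)).comp ρ) ∘ U) =
        fun i => v i * ((⇑((algebraMap A[Fin j → ℤ] (Localization.AtPrime 𝔔)).comp singleZeroRingHom) ∘ U) i) := by
      funext i
      exact hvU i
    rw [this, weightedMonomialIdeal_unit_mul _ _ hv]
  rw [hcomp₂, hrescale, ← hcomp₁, ← Ideal.map_map] at key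
  -- faithful flatness of `ψ₁`
  have := congrArg (Ideal.comap (Localization.localRingHom 𝔮 𝔔 singleZeroRingHom h1)) key
  rwa [@comap_map_localRingHom A A[Fin j → ℤ] _ _ singleZeroRingHom 𝔔 h𝔔p 𝔮 _ h1 _ (smooth_singleZeroRingHom A j),
    @comap_map_localRingHom A A[Fin j → ℤ] _ _ singleZeroRingHom 𝔔 h𝔔p 𝔮 _ h1 _ (smooth_singleZeroRingHom A j)] at this

include h𝔮' in
/-- **Cotangent independence of HOMOGENEOUS elements is core-stable (upward)**: if the homogeneous `Uᵢ` have linearly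
independent classes in the cotangent space of `A_{𝔮*}`, they have linearly independent classes in that of `A_𝔮`
(ascent along the coaction leg — flat, regular closed fibre —, unit rescaling `ρ Uᵢ = ι₀ Uᵢ · unit`, descent along the
local map `A_𝔮 → B`). [OURS · DESIGN MEMO v0 §2 (G-0) (d), for (reg)] -/
theorem linearIndependent_toCotangent_localization_of_homogeneousCore {N : ℕ} (U : Fin N → A)
    (hU : ∀ i, SetLike.IsHomogeneousElem 𝒜 (U i))
    (hU' : ∀ i, algebraMap A (Localization.AtPrime 𝔮') (U i) ∈ maximalIdeal (Localization.AtPrime 𝔮'))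
    (hli' : LinearIndependent (ResidueField (Localization.AtPrime 𝔮'))
      fun i => (maximalIdeal (Localization.AtPrime 𝔮')).toCotangent ⟨algebraMap A _ (U i), hU' i⟩)
    (hU𝔮 : ∀ i, algebraMap A (Localization.AtPrime 𝔮) (U i) ∈ maximalIdeal (Localization.AtPrime 𝔮)) :
    LinearIndependent (ResidueField (Localization.AtPrime 𝔮))
      fun i => (maximalIdeal (Localization.AtPrime 𝔮)).toCotangent ⟨algebraMap A _ (U i), hU𝔮 i⟩ := by
  classical
  obtain ⟨ρ, hρ, 𝔔, h𝔔p, h𝔔, h1, h2⟩ := exists_translate 𝒜 𝔮 𝔮' h𝔮'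
  haveI : IsNoetherianRing A[Fin j → ℤ] := Algebra.FiniteType.isNoetherianRing A _
  haveI i1 : IsLocalHom (Localization.localRingHom 𝔮 𝔔 singleZeroRingHom h1) :=
    Localization.isLocalHom_localRingHom 𝔮 𝔔 _ h1
  haveI i2 : IsLocalHom (Localization.localRingHom 𝔮' 𝔔 ρ h2) := Localization.isLocalHom_localRingHom 𝔮' 𝔔 _ h2
  -- the images in `B`
  have hy : ∀ i, Localization.localRingHom 𝔮 𝔔 singleZeroRingHom h1 (algebraMap A (Localization.AtPrime 𝔮) (U i)) ∈
      maximalIdeal (Localization.AtPrime 𝔔) := fun i => map_nonunit _ _ (hU𝔮 i)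
  have hx' : ∀ i, Localization.localRingHom 𝔮' 𝔔 ρ h2 (algebraMap A (Localization.AtPrime 𝔮') (U i)) ∈
      maximalIdeal (Localization.AtPrime 𝔔) := fun i => map_nonunit _ _ (hU' i)
  -- ascent along the coaction leg
  have hB := @linearIndependent_toCotangent_localRingHom_of_smooth A A[Fin j → ℤ] _ _ ρ 𝔔 h𝔔p 𝔮' _ h2 _ _
    (smooth_coaction 𝒜 ρ hρ) _ _ (fun i => algebraMap A (Localization.AtPrime 𝔮') (U i)) hU' hli' hx'
  -- unit rescaling: `ψ₂ (Uᵢ) = vᵢ * ψ₁ (Uᵢ)`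
  have hv : ∀ i, ∃ v : Localization.AtPrime 𝔔, IsUnit v ∧
      Localization.localRingHom 𝔮' 𝔔 ρ h2 (algebraMap A (Localization.AtPrime 𝔮') (U i)) =
        v * Localization.localRingHom 𝔮 𝔔 singleZeroRingHom h1 (algebraMap A (Localization.AtPrime 𝔮) (U i)) := by
    intro i
    obtain ⟨d, hd⟩ := hU i
    obtain ⟨v, hv, hvU⟩ := coaction_eq_single_zero_mul_unit 𝒜 ρ hρ hd
    refine ⟨algebraMap _ _ v, hv.map _, ?_⟩
    rw [Localization.localRingHom_to_map, Localization.localRingHom_to_map, hvU, map_mul]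
  choose v hvunit hvU using hv
  have hB' : LinearIndependent (ResidueField (Localization.AtPrime 𝔔)) fun i =>
      (maximalIdeal (Localization.AtPrime 𝔔)).toCotangent
        ⟨v i * Localization.localRingHom 𝔮 𝔔 singleZeroRingHom h1 (algebraMap A (Localization.AtPrime 𝔮) (U i)),
          (hvU i) ▸ hx' i⟩ := by
    convert hB using 3 with i
    exact Subtype.ext (hvU i).symm
  have hB'' := linearIndependent_toCotangent_of_unit_mul _ v hvunit _ hB' hy
  -- descent along `ψ₁`
  exact linearIndependent_toCotangent_of_map (Localization.localRingHom 𝔮 𝔔 singleZeroRingHom h1) _ hU𝔮 hy hB''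

end Core

end E2Model

end Summit.ResolutionOfSingularities.ResolutionOfSingularities.Cruxes.HypersurfaceCentreConstruction.LocalEngine

end
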